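import Mathlib
import HarnessLib
import Summits.HubbardSuperconductivity.HubbardSuperconductivity.Theorems.KLProgrammePlanarSoftPartnerSignBlind
import Summits.HubbardSuperconductivity.HubbardSuperconductivity.Theorems.KLProgrammeLatticeForwardBubble

/-!
# Route `KLProgramme` — crux K3, ENGINE child gen 6 (stmt-HubbardSuperconductivity-20236 `KLRegimeEngineV16`), stub `stub_engine_step_values`,
# (E2-v10) ph-loop inputs ON THE MODEL CARRIER `MatsubaraIdx M × TorusSite 2 L`: the β-UNIFORM sign-blind slice ⊗ SOFT-partner bubble at any
# bosonic frequency transfer (cell gate-hubbard-kl, seat hubbard-kl-k3c2-p2 g7)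

Turnkey composition, exactly as `…LatticeForwardBubble` (p490501) composes `klfb_planar_bubble_norm_le` with `klfl_matsubara_latticeAverage_norm_le_scale`:
here the planar input is `klhp_planar_soft_signblind_norm_le` (p519299).  The periodic integrand on the torus is
`F_i(p) = a_i(p)·Φ_f(ω_i, ẽ(p))·Φ_d(ω_i + 2πm₀/β, ẽ′(p))` (`a_i`, `ẽ`, `ẽ′` doubly `2π`-periodic; the SOFT partner `d` has no inner radius, so its
propagator at the fermionic partner frequency `ν_i = ω_i + 2πm₀/β ≠ 0` has sup `≤ M′/|ν_i| ≤ M′β/π` and `e`-Lipschitz constant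
`≤ 2L_d + M′/ν_i² ≤ 2L_d + M′β²/π²` — `klhl_soft_prop_norm_le`, `klhl_soft_prop_lipschitz_snd`; these β-dependent constants enter ONLY the lattice error
`32Λ_n·K/L`, which the engine's volume threshold `L ≥ klEngL₃ β U ≥ 2^{10}β²/U²` makes harmless).  Result: **`klhl_lattice_soft_signblind_norm_le`** —
`‖β⁻¹ • Σ_i L⁻² • Σ_k a_i(p_k)·Φ_f(ω_i, ẽ(p_k))·Φ_d(ω_i + 2πm₀/β, ẽ′(p_k))‖ ≤ (2π)⁻²·(2π·(512/π)·M_f·(A₀π√2/(Dt_min−κ₁))·M′) + 32Λ_n·K/L`, `K` explicit,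
uniformly in `β ≥ klBetaMin` (main term), `n ≤ n_β + 1`, `M`, `m₀`.

Pure analysis; nothing about the model's effective action is asserted; nothing asserts superconductivity.
-/

noncomputable section

namespace Summit.HubbardSuperconductivity.HubbardSuperconductivity.Theorems.KLRegimeSplit

set_option linter.dupNamespace false -- summit = problem name (single-conjunct summit), D-0017

open Real Set Filter MeasureTheory Complex Literature.MathematicalPhysics.QuantumLattice Literature.Probability.LatticeModels
open Literature.MathematicalPhysics.QuantumLattice.BandSectorCounting
open Summit.HubbardSuperconductivity.HubbardSuperconductivity.Theorems.PerturbedFermiCurve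
open Summit.HubbardSuperconductivity.HubbardSuperconductivity.Theorems.KLProgrammeLegKernels
open scoped NNReal

/-! ## §1 The soft propagator at a nonzero frequency: sup and `e`-Lipschitz constant -/

/-- The «resolvent» form of the propagator factor: `(iν + e)/(ν² + e²) = (e − iν)⁻¹` (`ν ≠ 0`). -/
theorem klhl_lin_div_eq_inv {ν : ℝ} (hν : ν ≠ 0) (e : ℝ) :
    (I * ν + e : ℂ) / (((ν ^ 2 + e ^ 2 : ℝ)) : ℂ) = ((e : ℂ) - I * ν)⁻¹ := by
  have hs : ((ν ^ 2 + e ^ 2 : ℝ) : ℂ) ≠ 0 := by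
    have : (0 : ℝ) < ν ^ 2 + e ^ 2 := by positivity
    exact_mod_cast this.ne'
  have hz : ((e : ℂ) - I * ν) ≠ 0 := by
    intro h
    have := congrArg Complex.im h
    simp at this
    exact hν this
  rw [div_eq_iff hs, inv_mul_eq_div, eq_div_iff hz]
  push_cast
  ring_nf
  rw [Complex.I_sq]
  ring

/-- `‖e − iν‖ = √(ν² + e²)`. -/
theorem klhl_norm_sub_I_mul (ν e : ℝ) : ‖((e : ℂ) - I * ν)‖ = Real.sqrt (ν ^ 2 + e ^ 2) := by
  have h : ((e : ℂ) - I * ν) = I * ((-ν : ℝ) : ℂ) + e := by push_cast; ring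
  rw [h, klzd_norm_lin, neg_sq]

/-- **Sup of the soft propagator at a nonzero frequency**: `‖Φ_d(ν, e)‖ ≤ M′/|ν|` (`‖d‖ ≤ M′`, `ν ≠ 0`). -/
theorem klhl_soft_prop_norm_le {d : ℝ → ℂ} {M' : ℝ} (hd : ∀ s, ‖d s‖ ≤ M') {ν : ℝ} (hν : ν ≠ 0) (e : ℝ) :
    ‖klfb_prop d ν e‖ ≤ M' / |ν| := by
  have hM' : 0 ≤ M' := (norm_nonneg _).trans (hd 0)
  have h := klhs_soft_propagator_norm_le hd hν e
  rw [klfb_prop_apply]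
  refine h.trans (div_le_div_of_nonneg_left hM' (abs_pos.mpr hν) ?_)
  rw [← Real.sqrt_sq_eq_abs]
  exact Real.sqrt_le_sqrt (by nlinarith [sq_nonneg e])

/-- **`e`-Lipschitz constant of the soft propagator at a nonzero frequency**: `‖Φ_d(ν,e) − Φ_d(ν,e′)‖ ≤ (2L_d + M′/ν²)·|e − e′|`
(`d` `L_d`-Lipschitz with `‖d‖ ≤ M′`, `ν ≠ 0`; the difference of weights is charged at the LARGER of `|e|, |e′|`, where `|e + e′|/√(ν² + e²) ≤ 2`). -/
theorem klhl_soft_prop_lipschitz_snd {d : ℝ → ℂ} {Ld M' : ℝ} (hlip : ∀ s s', ‖d s - d s'‖ ≤ Ld * |s - s'|) (hd : ∀ s, ‖d s‖ ≤ M')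
    {ν : ℝ} (hν : ν ≠ 0) (e e' : ℝ) :
    ‖klfb_prop d ν e - klfb_prop d ν e'‖ ≤ (2 * Ld + M' / ν ^ 2) * |e - e'| := by
  have hM' : 0 ≤ M' := (norm_nonneg _).trans (hd 0)
  have hLd : 0 ≤ Ld := by
    have := hlip 0 1; have h0 : (0:ℝ) ≤ ‖d 0 - d 1‖ := norm_nonneg _; norm_num at this; linarith
  have hν2 : 0 < ν ^ 2 := by positivity
  -- resolvent form
  have hw : ∀ x : ℝ, klfb_prop d ν x = d (ν ^ 2 + x ^ 2) * ((x : ℂ) - I * ν)⁻¹ := by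
    intro x; rw [klfb_prop_apply, div_mul_eq_mul_div, mul_div_assoc, klhl_lin_div_eq_inv hν]
  have hz : ∀ x : ℝ, ((x : ℂ) - I * ν) ≠ 0 := by
    intro x h
    have := congrArg Complex.im h
    simp at this
    exact hν this
  have hnz : ∀ x : ℝ, |ν| ≤ ‖((x : ℂ) - I * ν)‖ := by
    intro x
    rw [klhl_norm_sub_I_mul, ← Real.sqrt_sq_eq_abs]
    exact Real.sqrt_le_sqrt (by nlinarith [sq_nonneg x])
  have hnx : ∀ x : ℝ, |x| ≤ ‖((x : ℂ) - I * ν)‖ := by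
    intro x
    rw [klhl_norm_sub_I_mul, ← Real.sqrt_sq_eq_abs]
    exact Real.sqrt_le_sqrt (by nlinarith [sq_nonneg ν])
  have hνa : 0 < |ν| := abs_pos.mpr hν
  -- the difference of resolvents
  have hres : ∀ x y : ℝ, ‖((x : ℂ) - I * ν)⁻¹ - ((y : ℂ) - I * ν)⁻¹‖ ≤ |x - y| / ν ^ 2 := by
    intro x y
    rw [inv_sub_inv (hz x) (hz y), norm_div, norm_mul]
    have hnum : ‖((y : ℂ) - I * ν - ((x : ℂ) - I * ν))‖ = |x - y| := by
      rw [show ((y : ℂ) - I * ν - ((x : ℂ) - I * ν)) = ((y - x : ℝ) : ℂ) by push_cast; ring, Complex.norm_real, Real.norm_eq_abs, abs_sub_comm]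
    rw [hnum]
    refine div_le_div_of_nonneg_left (abs_nonneg _) hν2 ?_
    rw [← sq_abs ν, sq]
    exact mul_le_mul (hnz x) (hnz y) hνa.le (norm_nonneg _)
  -- the ordered case `|x| ≤ |y|`
  have hord : ∀ x y : ℝ, |x| ≤ |y| → ‖klfb_prop d ν x - klfb_prop d ν y‖ ≤ (2 * Ld + M' / ν ^ 2) * |x - y| := by
    intro x y hxy
    rw [hw x, hw y]
    have hsplit : d (ν ^ 2 + x ^ 2) * ((x : ℂ) - I * ν)⁻¹ - d (ν ^ 2 + y ^ 2) * ((y : ℂ) - I * ν)⁻¹ =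
        (d (ν ^ 2 + x ^ 2) - d (ν ^ 2 + y ^ 2)) * ((y : ℂ) - I * ν)⁻¹ +
          d (ν ^ 2 + x ^ 2) * (((x : ℂ) - I * ν)⁻¹ - ((y : ℂ) - I * ν)⁻¹) := by ring
    rw [hsplit]
    have hy0 : 0 < ‖((y : ℂ) - I * ν)‖ := lt_of_lt_of_le hνa (hnz y)
    -- first term: `L_d |x² − y²| / ‖y − iν‖ ≤ 2 L_d |x − y|`
    have h1 : ‖(d (ν ^ 2 + x ^ 2) - d (ν ^ 2 + y ^ 2)) * ((y : ℂ) - I * ν)⁻¹‖ ≤ 2 * Ld * |x - y| := by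
      rw [norm_mul, norm_inv]
      have hdd := hlip (ν ^ 2 + x ^ 2) (ν ^ 2 + y ^ 2)
      have hsq : |ν ^ 2 + x ^ 2 - (ν ^ 2 + y ^ 2)| = |x - y| * |x + y| := by
        rw [show ν ^ 2 + x ^ 2 - (ν ^ 2 + y ^ 2) = (x - y) * (x + y) by ring, abs_mul]
      rw [hsq] at hdd
      have hxy' : |x + y| ≤ 2 * ‖((y : ℂ) - I * ν)‖ := by
        calc |x + y| ≤ |x| + |y| := abs_add_le _ _
          _ ≤ |y| + |y| := by linarith
          _ ≤ 2 * ‖((y : ℂ) - I * ν)‖ := by linarith [hnx y]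
      calc ‖d (ν ^ 2 + x ^ 2) - d (ν ^ 2 + y ^ 2)‖ * ‖((y : ℂ) - I * ν)‖⁻¹
          ≤ (Ld * (|x - y| * (2 * ‖((y : ℂ) - I * ν)‖))) * ‖((y : ℂ) - I * ν)‖⁻¹ := by
            refine mul_le_mul_of_nonneg_right (hdd.trans ?_) (inv_nonneg.mpr (norm_nonneg _))
            exact mul_le_mul_of_nonneg_left (mul_le_mul_of_nonneg_left hxy' (abs_nonneg _)) hLd
        _ = 2 * Ld * |x - y| := by field_simp
    -- second term: `M' |x − y| / ν²`
    have h2 : ‖d (ν ^ 2 + x ^ 2) * (((x : ℂ) - I * ν)⁻¹ - ((y : ℂ) - I * ν)⁻¹)‖ ≤ M' * (|x - y| / ν ^ 2) := by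
      rw [norm_mul]
      exact mul_le_mul (hd _) (hres x y) (norm_nonneg _) hM'
    calc _ ≤ ‖(d (ν ^ 2 + x ^ 2) - d (ν ^ 2 + y ^ 2)) * ((y : ℂ) - I * ν)⁻¹‖ +
          ‖d (ν ^ 2 + x ^ 2) * (((x : ℂ) - I * ν)⁻¹ - ((y : ℂ) - I * ν)⁻¹)‖ := norm_add_le _ _
      _ ≤ 2 * Ld * |x - y| + M' * (|x - y| / ν ^ 2) := add_le_add h1 h2
      _ = (2 * Ld + M' / ν ^ 2) * |x - y| := by ring
  rcases le_total |e| |e'| with h | h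
  · exact hord e e' h
  · rw [norm_sub_rev, abs_sub_comm]; exact hord e' e h

/-! ## §2 The sign-blind slice ⊗ soft bubble on the model carrier -/

section Lattice

variable {a' b' : ℝ} (B : BandBounds a' b') {δ : (Fin 2 → ℝ) → ℝ} (hδ1 : ContDiff ℝ 1 δ) {κ₀ κ₁ : ℝ}
  (hδ : ∀ k : Fin 2 → ℝ, (∀ i, |k i| ≤ π) → |δ k| ≤ κ₀)
  (hκ : ∀ k : Fin 2 → ℝ, (∀ i, |k i| ≤ π) → ‖fderiv ℝ δ k‖ ≤ κ₁) (hκ₁ : κ₁ < B.Dtmin)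

include B hδ1 hδ hκ hκ₁ in
/-- **THE SIGN-BLIND SLICE ⊗ SOFT BUBBLE ON `MatsubaraIdx M × TorusSite 2 L`, β-UNIFORM, ANY BOSONIC TRANSFER.**  Data: the frame (margin window);
frequency-dependent doubly `2π`-periodic continuous weights `a_i` (`‖a_i‖ ≤ A₀`, `L_a`-Lipschitz in the sup metric, `A₀, L_a ≥ 0`); the periodic frame band `ẽ`
(continuous, `L_e`-Lipschitz, `= klfb_band δ μ` on the closed square) and the periodic shifted band `ẽ′` (continuous, `L_e′`-Lipschitz) whose ray
shift `klfb_shift δ μ ẽ′ θ` is `½`-Lipschitz on `[−4Λ_n, 4Λ_n]` for every angle; the zone margin `zm > 0`; the slice-`n` weight `f` (`L_f ≤ ℓ_f/Λ_n²`,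
`‖f‖ ≤ M_f`, window `[Λ_n/2, 4Λ_n]`); the soft weight `d` (`L_d`-Lipschitz, `‖d‖ ≤ M′`); `β ≥ klBetaMin`, `n ≤ n_β + 1`, any `M`, `m₀ : ℤ`.  With
`K := L_a·(2M_f/Λ_n)·(M′β/π) + A₀·((9ℓ_f+4M_f)L_e/Λ_n²)·(M′β/π) + A₀·(2M_f/Λ_n)·((2L_d + M′β²/π²)·L_e′)`:
`‖β⁻¹ • Σ_i L⁻² • Σ_k a_i(p_k)·Φ_f(ω_i, ẽ(p_k))·Φ_d(ω_i + 2πm₀/β, ẽ′(p_k))‖ ≤ (2π)⁻²·(2π·(512/π)·M_f·(A₀π√2/(Dt_min−κ₁))·M′) + 32Λ_n·K/L`. -/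
theorem klhl_lattice_soft_signblind_norm_le
    {M : ℕ} {a : MatsubaraIdx M → ℝ × ℝ → ℂ} (ha : ∀ i, Continuous (a i)) (ha1 : ∀ i x y, a i (x + 2 * π, y) = a i (x, y))
    (ha2 : ∀ i x y, a i (x, y + 2 * π) = a i (x, y))
    {A₀ La : ℝ} (hA00 : 0 ≤ A₀) (hA0 : ∀ i p, ‖a i p‖ ≤ A₀) (hLa0 : 0 ≤ La) (hLa : ∀ i p q, ‖a i p - a i q‖ ≤ La * dist p q)
    {eb : ℝ × ℝ → ℝ} (hebc : Continuous eb) (heb1 : ∀ x y, eb (x + 2 * π, y) = eb (x, y)) (heb2 : ∀ x y, eb (x, y + 2 * π) = eb (x, y))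
    {Le : ℝ} (hLe : ∀ p q, |eb p - eb q| ≤ Le * dist p q) {μ : ℝ} (heb : ∀ p ∈ Icc (-π) π ×ˢ Icc (-π) π, eb p = klfb_band δ μ p)
    {eb' : ℝ × ℝ → ℝ} (heb'c : Continuous eb') (heb'1 : ∀ x y, eb' (x + 2 * π, y) = eb' (x, y)) (heb'2 : ∀ x y, eb' (x, y + 2 * π) = eb' (x, y))
    {Le' : ℝ} (hLe' : ∀ p q, |eb' p - eb' q| ≤ Le' * dist p q)
    {zm : ℝ} (hzm : 0 < zm) {n : ℕ}
    (hzone : ∀ p ∈ Icc (-π) π ×ˢ Icc (-π) π, |eb p| < 4 * klScale klE0 n → |p.1| ≤ π - 2 * zm ∧ |p.2| ≤ π - 2 * zm)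
    (hσ : ∀ θ : ℝ, ∀ e ∈ Icc (-(4 * klScale klE0 n)) (4 * klScale klE0 n), ∀ e'' ∈ Icc (-(4 * klScale klE0 n)) (4 * klScale klE0 n),
      |klfb_shift δ μ eb' θ e - klfb_shift δ μ eb' θ e''| ≤ |e - e''| / 2)
    {f d : ℝ → ℂ} {Lf Mf ℓf Ld M' : ℝ}
    (hlip : ∀ s s', ‖f s - f s'‖ ≤ Lf * |s - s'|) (hbd : ∀ s, ‖f s‖ ≤ Mf) (hLf : Lf ≤ ℓf / klScale klE0 n ^ 2)
    (hin : ∀ s, s ≤ (klScale klE0 n / 2) ^ 2 → f s = 0) (hout : ∀ s, (4 * klScale klE0 n) ^ 2 ≤ s → f s = 0)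
    (hdlip : ∀ s s', ‖d s - d s'‖ ≤ Ld * |s - s'|) (hdbd : ∀ s, ‖d s‖ ≤ M')
    (hlo : a' < μ - 4 * klScale klE0 n - κ₀) (hhi : μ + 4 * klScale klE0 n + κ₀ < b')
    {β : ℝ} (hβ : klBetaMin ≤ β) (hn : n ≤ nScales β + 1) (m₀ : ℤ) (L : ℕ) [NeZero L] :
    ‖β⁻¹ • ∑ i : MatsubaraIdx M, ((L ^ 2 : ℕ) : ℝ)⁻¹ • ∑ k : TorusSite 2 L,
        a i (latticeMomentum L k 0, latticeMomentum L k 1) *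
          klfb_prop f (matsubaraFreq β M i) (eb (latticeMomentum L k 0, latticeMomentum L k 1)) *
            klfb_prop d (matsubaraFreq β M i + 2 * Real.pi * (m₀ : ℝ) / β) (eb' (latticeMomentum L k 0, latticeMomentum L k 1))‖ ≤
      ((2 * π) ^ 2)⁻¹ * (2 * Real.pi * (512 / Real.pi * Mf * (A₀ * (Real.pi * Real.sqrt 2 / (B.Dtmin - κ₁)) * M'))) +
        32 * klScale klE0 n *
            (La * (2 * Mf / klScale klE0 n) * (M' * β / Real.pi) +
              A₀ * ((9 * ℓf + 4 * Mf) / klScale klE0 n ^ 2 * Le) * (M' * β / Real.pi) +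
              A₀ * (2 * Mf / klScale klE0 n) * ((2 * Ld + M' * β ^ 2 / Real.pi ^ 2) * Le')) / L := by
  have hδc : Continuous δ := hδ1.continuous
  have hΛ := klth_klScale_pos n
  have hβ0 : 0 < β := pos_of_klBetaMin_le hβ
  have hπ := Real.pi_pos
  have hr₁ : 0 < klScale klE0 n / 2 := by positivity
  have hr : 0 < 4 * klScale klE0 n := by positivity
  have hMf : 0 ≤ Mf := (norm_nonneg _).trans (hbd 0)
  have hM' : 0 ≤ M' := (norm_nonneg _).trans (hdbd 0)
  have hLd : 0 ≤ Ld := by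
    have := hdlip 0 1; have h0 : (0:ℝ) ≤ ‖d 0 - d 1‖ := norm_nonneg _; norm_num at this; linarith
  have hLe0 : 0 ≤ Le := by
    have h := hLe (1, 0) (0, 0)
    have hdist : (0 : ℝ) < dist ((1 : ℝ), (0 : ℝ)) ((0 : ℝ), (0 : ℝ)) := by rw [Prod.dist_eq]; simp
    exact nonneg_of_mul_nonneg_left ((abs_nonneg _).trans h) hdist
  have hLe'0 : 0 ≤ Le' := by
    have h := hLe' (1, 0) (0, 0)
    have hdist : (0 : ℝ) < dist ((1 : ℝ), (0 : ℝ)) ((0 : ℝ), (0 : ℝ)) := by rw [Prod.dist_eq]; simp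
    exact nonneg_of_mul_nonneg_left ((abs_nonneg _).trans h) hdist
  have hℓf : 0 ≤ 9 * ℓf + 4 * Mf := by
    have hLf0 : 0 ≤ Lf := by have := hlip 0 1; norm_num at this; linarith [norm_nonneg (f 0 - f 1)]
    have : 0 ≤ ℓf := by
      have h := hLf0.trans hLf; rwa [le_div_iff₀ (by positivity), zero_mul] at h
    positivity
  set q₀ : ℝ := 2 * Real.pi * (m₀ : ℝ) / β with hq₀
  -- the partner frequencies are fermionic: `|ν_i| ≥ π/β`
  have hν : ∀ i : MatsubaraIdx M, matsubaraFreq β M i + q₀ = Real.pi * (2 * ((matsubaraInt M i + m₀ : ℤ) : ℝ) + 1) / β :=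
    fun i => klhp_matsubaraFreq_add_bosonic β M i m₀
  have hνabs : ∀ i : MatsubaraIdx M, Real.pi / β ≤ |matsubaraFreq β M i + q₀| := by
    intro i
    rw [hν i, abs_div, abs_of_pos hβ0, abs_mul, abs_of_pos hπ]
    refine div_le_div_of_nonneg_right ?_ hβ0.le
    have hodd : (1 : ℝ) ≤ |2 * ((matsubaraInt M i + m₀ : ℤ) : ℝ) + 1| := by
      have h : (1 : ℤ) ≤ |2 * (matsubaraInt M i + m₀) + 1| := by
        rcases le_or_gt 0 (matsubaraInt M i + m₀) with h0 | h0
        · rw [abs_of_nonneg (by omega)]; omega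
        · rw [abs_of_neg (by omega)]; omega
      exact_mod_cast h
    nlinarith
  have hν0 : ∀ i : MatsubaraIdx M, matsubaraFreq β M i + q₀ ≠ 0 := fun i h => by
    have := hνabs i; rw [h, abs_zero] at this; linarith [div_pos hπ hβ0]
  -- the planar weights `A_i = a_i·ψ`
  set A : MatsubaraIdx M → ℝ × ℝ → ℂ := fun i p => a i p * (klfl_squareCut zm p : ℂ) with hAdef
  have hψbd : ∀ p, ‖(klfl_squareCut zm p : ℂ)‖ ≤ 1 := fun p => by
    rw [Complex.norm_real, Real.norm_of_nonneg (klfl_squareCut_mem zm p).1]; exact (klfl_squareCut_mem zm p).2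
  have hAc : ∀ i, Continuous (A i) := fun i => (ha i).mul (Complex.continuous_ofReal.comp (klfl_continuous_squareCut zm))
  have hAsupp : ∀ i, ∀ p : ℝ × ℝ, A i p ≠ 0 → |p.1| < π ∧ |p.2| < π := by
    intro i p hp
    have hψ : klfl_squareCut zm p ≠ 0 := fun h0 => hp (by simp only [hAdef, h0, Complex.ofReal_zero, mul_zero])
    obtain ⟨h1, h2⟩ := klfl_abs_lt_of_squareCut_ne_zero hzm hψ
    exact ⟨by linarith, by linarith⟩
  have hAbd : ∀ i p, ‖A i p‖ ≤ A₀ := fun i p => by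
    simp only [hAdef]; rw [norm_mul]
    calc ‖a i p‖ * ‖(klfl_squareCut zm p : ℂ)‖ ≤ A₀ * 1 := mul_le_mul (hA0 i p) (hψbd p) (norm_nonneg _) hA00
      _ = A₀ := mul_one _
  -- the planar bound
  have hB := klhp_planar_soft_signblind_norm_le B hδ1 hδ hκ hκ₁ hAc hAsupp hA00 hAbd hlip hbd hin hout hdlip hdbd heb'c hσ hlo hhi hβ hn m₀
  -- the periodic family and its properties
  set F : MatsubaraIdx M → ℝ × ℝ → ℂ := fun i p =>
    a i p * klfb_prop f (matsubaraFreq β M i) (eb p) * klfb_prop d (matsubaraFreq β M i + q₀) (eb' p) with hFdef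
  have hΦc : ∀ k₀, Continuous fun e => klfb_prop f k₀ e := fun k₀ => klfb_continuous_prop_snd hlip hbd hin hout hr₁ hr k₀
  have hΨc : ∀ i, Continuous fun e => klfb_prop d (matsubaraFreq β M i + q₀) e := fun i => klhp_continuous_prop_of_ne hdlip (hν0 i)
  have hFc : ∀ i, Continuous (F i) := fun i => ((ha i).mul ((hΦc _).comp hebc)).mul ((hΨc i).comp heb'c)
  have hF1 : ∀ i x y, F i (x + 2 * π, y) = F i (x, y) := fun i x y => by simp only [hFdef, ha1, heb1, heb'1]
  have hF2 : ∀ i x y, F i (x, y + 2 * π) = F i (x, y) := fun i x y => by simp only [hFdef, ha2, heb2, heb'2]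
  -- β-dependent sup and Lipschitz constants of the soft partner
  have hsupD : ∀ i e, ‖klfb_prop d (matsubaraFreq β M i + q₀) e‖ ≤ M' * β / Real.pi := by
    intro i e
    refine (klhl_soft_prop_norm_le hdbd (hν0 i) e).trans ?_
    rw [div_le_iff₀ (lt_of_lt_of_le (div_pos hπ hβ0) (hνabs i))]
    calc M' = M' * β / Real.pi * (Real.pi / β) := by field_simp
      _ ≤ M' * β / Real.pi * |matsubaraFreq β M i + q₀| := mul_le_mul_of_nonneg_left (hνabs i) (by positivity)
  have hlipD : ∀ i e e', ‖klfb_prop d (matsubaraFreq β M i + q₀) e - klfb_prop d (matsubaraFreq β M i + q₀) e'‖ ≤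
      (2 * Ld + M' * β ^ 2 / Real.pi ^ 2) * |e - e'| := by
    intro i e e'
    refine (klhl_soft_prop_lipschitz_snd hdlip hdbd (hν0 i) e e').trans (mul_le_mul_of_nonneg_right ?_ (abs_nonneg _))
    have h1 : (Real.pi / β) ^ 2 ≤ (matsubaraFreq β M i + q₀) ^ 2 := by
      rw [← sq_abs (matsubaraFreq β M i + q₀)]
      exact pow_le_pow_left₀ (by positivity) (hνabs i) 2
    have h2 : M' / (matsubaraFreq β M i + q₀) ^ 2 ≤ M' / (Real.pi / β) ^ 2 := div_le_div_of_nonneg_left hM' (by positivity) h1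
    have h3 : M' / (Real.pi / β) ^ 2 = M' * β ^ 2 / Real.pi ^ 2 := by field_simp
    linarith
  set K : ℝ := La * (2 * Mf / klScale klE0 n) * (M' * β / Real.pi) +
    A₀ * ((9 * ℓf + 4 * Mf) / klScale klE0 n ^ 2 * Le) * (M' * β / Real.pi) +
    A₀ * (2 * Mf / klScale klE0 n) * ((2 * Ld + M' * β ^ 2 / Real.pi ^ 2) * Le') with hKdef
  have hK0 : 0 ≤ K := by rw [hKdef]; positivity
  have hFlip' : ∀ i (p q : ℝ × ℝ), ‖F i p - F i q‖ ≤ (K.toNNReal : ℝ) * dist p q := by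
    intro i p q
    rw [Real.coe_toNNReal _ hK0]
    have hv : ∀ p q : ℝ × ℝ, ‖klfb_prop f (matsubaraFreq β M i) (eb p) - klfb_prop f (matsubaraFreq β M i) (eb q)‖ ≤
        (9 * ℓf + 4 * Mf) / klScale klE0 n ^ 2 * Le * dist p q :=
      fun p q => (klfl_prop_lipschitz_snd hlip hbd hLf hin hout (matsubaraFreq β M i) (eb p) (eb q)).trans (by
        rw [mul_assoc]; exact mul_le_mul_of_nonneg_left (hLe p q) (by positivity))
    have hw : ∀ p q : ℝ × ℝ, ‖klfb_prop d (matsubaraFreq β M i + q₀) (eb' p) - klfb_prop d (matsubaraFreq β M i + q₀) (eb' q)‖ ≤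
        (2 * Ld + M' * β ^ 2 / Real.pi ^ 2) * Le' * dist p q :=
      fun p q => (hlipD i (eb' p) (eb' q)).trans (by
        rw [mul_assoc]; exact mul_le_mul_of_nonneg_left (hLe' p q) (by positivity))
    exact klfl_lipschitz_triple (u := a i) (v := fun p => klfb_prop f (matsubaraFreq β M i) (eb p))
      (w := fun p => klfb_prop d (matsubaraFreq β M i + q₀) (eb' p))
      (hA0 i) (fun p => klfl_prop_norm_le hbd hin (matsubaraFreq β M i) (eb p)) (fun p => hsupD i (eb' p)) (hLa i) hv hw p q
  have hFh : ∀ i, ∀ p ∈ Icc (-π) π ×ˢ Icc (-π) π, F i p = klfb_integrand δ μ (A i) f d eb' (matsubaraFreq β M i) q₀ p :=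
    fun i p hp => klfl_integrand_eq_on_square hzm heb hzone hout (matsubaraFreq β M i) q₀ hp
  have hh0 : ∀ i, ∀ p ∉ Icc (-π) π ×ˢ Icc (-π) π, klfb_integrand δ μ (A i) f d eb' (matsubaraFreq β M i) q₀ p = 0 :=
    fun i p hp => klfl_integrand_eq_zero_off_square hzm (matsubaraFreq β M i) q₀ hp
  have hzero : ∀ i, 4 * klScale klE0 n ≤ |matsubaraFreq β M i| → ∀ p, F i p = 0 := by
    intro i hi p
    simp only [hFdef]
    rw [klfl_prop_eq_zero_of_le_abs_fst hout hi, mul_zero, zero_mul]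
  have h := klfl_matsubara_latticeAverage_norm_le_scale (F := F) (h := fun i => klfb_integrand δ μ (A i) f d eb' (matsubaraFreq β M i) q₀)
    hβ hn hFc hF1 hF2 hFlip' hFh hh0 hzero hB L
  rw [Real.coe_toNNReal _ hK0] at h
  exact h

end Lattice

end Summit.HubbardSuperconductivity.HubbardSuperconductivity.Theorems.KLRegimeSplit

end
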